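import Summits.CriticalPhenomena.PercolationContinuityZ3.Theorems.PercNearOneGluingNoHeavyLowerTailKnQuestion8CoefficientwiseLeafNA

/-!
# The one-sided two-colouring form of van den Berg–Häggström–Kahn's Theorem 1.4 holds on every finite multigraph

Support file (`--supports stmt-CriticalPhenomena-4575`, closed), prover `prim-cplus-coupling` (gen 24); companion of
`…KnQuestion8CoefficientwiseLeafNA.lean` (gen 22, "Theorem P"), whose local notation and lemmas (`cl_Phi`, `Phi_Phi`,
`cl_subset_cl_compl_Phi`) are reused.  Memo `prim-cplus-coupling/A5-COUPLING-gen24.md` §2.  No definitions, no named facts,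
no sorries; standard axioms.

Setting (as in the companion file).  A finite multigraph is `ends : ι → Sym2 V`; a two-colouring is a set `t : Finset ι` of red
edges (`tᶜ` blue); `CL[t, a]` is the red vertex cluster of `a`.  The two-colouring ("coefficientwise", all-edge joint Bernstein)
form of vdBHK's Theorem 1.4 is `Δ(f,g) := Σ_t 1[x ∉ cl t z] 1[x ∉ cl tᶜ z] f(cl t x) (g(cl tᶜ z) − g(cl t z)) ≥ 0` (open in general;
proved for a leaf source in the companion file).  THIS FILE proves the ONE-SIDED version in which only the red `x–z` disconnection is
imposed, for every finite multigraph, every monotone `g` and every NONNEGATIVE weight `f` (not necessarily monotone):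

  `twoColouring_bhk14_oneSided`:  `0 ≤ Σ_{t ⊆ ι} 1[x ∉ cl t z] · f(cl t x) · (g(cl tᶜ z) − g(cl t z))`.

In words: among the two-colourings with no red `x–z` path, weighted by `f` of the red cluster of `x`, the BLUE cluster of `z` is
(weakly) larger in distribution than the RED cluster of `z`.  By the minor reduction (contract the edges open in both copies, delete
those closed in both) this is the statement that every joint all-edge Bernstein coefficient of the two-copy polynomial
`(∫_{x↮z} f(C_x) dμ_p)(∫ g(C_z) dμ_p) − ∫_{x↮z} f(C_x) g(C_z) dμ_p` is nonnegative — the coefficientwise form of the MEASURE-level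
consequence `E[f g ; x↮z] ≤ E[f ; x↮z]·E[g]` of Thm. 1.4 and Harris' inequality.  (The two-sided `Δ ≥ 0`, i.e. the coefficientwise
form of Thm. 1.4 itself, differs from this by the nonnegative mass of the colourings with a blue but no red `x–z` path; that is where
the open problem lives — memo §2.)
Proof: on `T = {t : x ∉ cl t z}` the map `Φ t = (t ∩ I) ∪ (Iᶜ \ t)`, `I` = edges meeting `cl t x`, is an involution of `T` preserving
`cl · x` and with `cl t z ⊆ cl (Φ t)ᶜ z` (a red path from `z` never meets the red cluster of `x`, and off that cluster `Φ` swaps the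
colours); so `Σ_T f(cl t x) g(cl t z) ≤ Σ_T f(cl t x) g(cl (Φ t)ᶜ z) = Σ_T f(cl t x) g(cl tᶜ z)` after reindexing by `Φ`.
[cite: VandenbergHaggstromKahn2005, Thm. 1.4 (p. 7)]; context [cite: KozmaNitzan2024, Questions 8–9 (§5.5 p. 36)].
-/

noncomputable section

open Finset
open scoped Classical

namespace Summit.CriticalPhenomena.PercolationContinuityZ3.Theorems

namespace CoefficientwiseNA

variable {V : Type*} [Fintype V] [DecidableEq V] {ι : Type*} [Fintype ι] [DecidableEq ι]

variable (ends : ι → Sym2 V)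

/-- The graph of the red edges `t` (as in the companion file; local notation only). -/
local notation "OG[" t "]" => SimpleGraph.fromEdgeSet (Finset.image ends t : Set (Sym2 V))
/-- The red vertex cluster of `a`. -/
local notation "CL[" t ", " a "]" => Finset.filter (fun v => SimpleGraph.Reachable (OG[t]) a v) Finset.univ
/-- The edges meeting a vertex set `S`. -/
local notation "MEETS[" S "]" => Finset.filter (fun e => ∃ v ∈ S, v ∈ ends e) Finset.univ
/-- Keep the colours on `I`, swap them off `I`. -/
local notation "FLIP[" t ", " I "]" => ((t ∩ I) ∪ (Iᶜ \ t))
/-- Keep the colours on the edges meeting the red cluster of `a`, swap all the others. -/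
local notation "PHI[" t ", " a "]" => FLIP[t, MEETS[CL[t, a]]]

omit [Fintype ι] [DecidableEq ι] in
/-- `x` lies outside the red cluster of `z` iff `z` lies outside the red cluster of `x`. [folklore] -/
theorem not_mem_cl_comm {t : Finset ι} {x z : V} : x ∉ CL[t, z] ↔ z ∉ CL[t, x] := by
  rw [mem_cl, mem_cl]
  exact not_congr ⟨fun h => h.symm, fun h => h.symm⟩

/-- **One-sided two-colouring form of vdBHK Theorem 1.4 (every finite multigraph).**  For `ends : ι → Sym2 V`, vertices `x, z`,
a nonnegative weight `f : Finset V → ℝ` (monotonicity of `f` is NOT needed) and a monotone `g : Finset V → ℝ`: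
`0 ≤ Σ_{t ⊆ ι} 1[x ∉ cl t z] · f(cl t x) · (g(cl tᶜ z) − g(cl t z))` — among the two-colourings with no red `x–z` path, weighted by
`f` of the red cluster of `x`, the blue cluster of `z` dominates the red cluster of `z`.  (Coefficientwise form of
`E[f g ; x ↮ z] ≤ E[f ; x ↮ z] E[g]`; the two-sided version — the coefficientwise form of Thm. 1.4 itself — is open.)
[cite: VandenbergHaggstromKahn2005, Thm. 1.4 (p. 7)] -/
theorem twoColouring_bhk14_oneSided (x z : V) (f g : Finset V → ℝ) (hf0 : ∀ S, 0 ≤ f S) (hg : Monotone g) :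
    0 ≤ ∑ t : Finset ι, (if x ∉ CL[t, z] then f (CL[t, x]) * (g (CL[tᶜ, z]) - g (CL[t, z])) else 0) := by
  set T : Finset (Finset ι) := univ.filter fun t => x ∉ CL[t, z] with hT
  have memT : ∀ t, t ∈ T ↔ x ∉ CL[t, z] := fun t => by simp [hT]
  have step1 : ∑ t : Finset ι, (if x ∉ CL[t, z] then f (CL[t, x]) * (g (CL[tᶜ, z]) - g (CL[t, z])) else 0)
      = ∑ t ∈ T, f (CL[t, x]) * (g (CL[tᶜ, z]) - g (CL[t, z])) := by
    rw [hT, Finset.sum_filter]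
  rw [step1, Finset.sum_congr rfl fun t _ => (mul_sub (f (CL[t, x])) _ _), Finset.sum_sub_distrib, sub_nonneg]
  -- `Φ = PHI[·, x]` maps `T` to itself
  have hPhiT : ∀ t ∈ T, PHI[t, x] ∈ T := by
    intro t ht
    have hz : z ∉ CL[t, x] := (not_mem_cl_comm ends).1 ((memT t).1 ht)
    refine (memT _).2 ((not_mem_cl_comm ends).2 ?_)
    rwa [cl_Phi]
  calc ∑ t ∈ T, f (CL[t, x]) * g (CL[t, z])
      ≤ ∑ t ∈ T, f (CL[t, x]) * g (CL[(PHI[t, x])ᶜ, z]) :=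
        Finset.sum_le_sum fun t ht =>
          mul_le_mul_of_nonneg_left
            (hg (cl_subset_cl_compl_Phi ends ((not_mem_cl_comm ends).1 ((memT t).1 ht)))) (hf0 _)
    _ = ∑ t ∈ T, f (CL[t, x]) * g (CL[tᶜ, z]) := by
        refine Finset.sum_bij' (fun t _ => PHI[t, x]) (fun t _ => PHI[t, x]) hPhiT hPhiT
          (fun t _ => Phi_Phi ends t x) (fun t _ => Phi_Phi ends t x) ?_
        intro t _
        simp only [cl_Phi]
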